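import Mathlib
import Literature.Analysis.FluidPDE.SelfSimilarEulerProfile
import HarnessLib

/-!
# R49 plate t52-MV, part 1: the TENT WEIGHTS for the mean-value formula (regularised radial test functions)
# (nsreg-p2 ROUND-49 «EVERY BALL BREATHES», `NsregP2.R49.MeanValueFormula`; seat ns-sfl-p1 g8,
# `--supports stmt-NavierStokesRegularity-19832 --as helper`)

For a `γ`-profile `(V, P)` with ANY similarity centre `c` and every centre `x₀`, radius `δ > 0` (`z = y − x₀`):
`∫_{B_δ(x₀)} (⟪V,z⟫²/‖z‖ + ‖z‖·P) dy = ∫_{B_δ(x₀)} (δ − ‖z‖)(‖V‖² + 3P) dy`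
— Chae–Wolf 2016 Lemma 2.1 (2.1) in tent form (ball integrals only), γ-free.

This file: the weights only (part 2 `…BallMeanValue` runs the dominated-convergence passage and states the formula).
Plan of the proof (ONE dominated-convergence passage from ns-ezl-w2 g5's `ClassicalProfile.radialVirialIdentity`, t52-RV): the radial
virial identity `∫ ψ(‖z‖²)‖V‖² + 2ψ′(‖z‖²)⟪V,z⟫² + P(3ψ(‖z‖²) + 2‖z‖²ψ′(‖z‖²)) = 0` is tested with the `C¹_c` weights
`ψ_k(s) = g_k(√|s|)`, `g_k(t) = ∫_t^δ χ_k`, `χ_k(t) = S((k+1)t − 1)·S((k+1)(δ − t))` (`S` = `Real.smoothTransition`): `χ_k` is smooth,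
`0 ≤ χ_k ≤ 1`, vanishes on `t ≤ 1/(k+1)` (so `ψ_k` is locally constant across `s = 0` — no `1/√s` singularity) and on `t ≥ δ`
(compact support), and `χ_k → 1` on `(0, δ)`; hence `g_k ∈ C¹`, `0 ≤ g_k ≤ (δ − t)₊`, `g_k → (δ − t)₊`, and along `s = ‖z‖²` the
RV integrand is `g_k(‖z‖)‖V‖² − χ_k(‖z‖)⟪V,z⟫²/‖z‖ + P(3g_k(‖z‖) − ‖z‖χ_k(‖z‖))`, dominated by `(2δ‖V‖² + 4δ|P|)·1_{B̄_δ(x₀)}` and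
converging EVERYWHERE to `1_{B_δ(x₀)}[(δ − ‖z‖)‖V‖² − ⟪V,z⟫²/‖z‖ + P(3(δ − ‖z‖) − ‖z‖)]`, whose integral is the difference of the
two sides of the formula.

HONEST FRAMING: an instrument identity of ROUND-49 (class-free, about hypothetical profiles); nothing about the crux E (19832 OPEN)
or NS regularity is proved here. [cite: ChaeWolf2016, Lemma 2.1 (2.1)] [nsreg-p2 R49 §2.3; folklore (regularised radial test
functions)]
-/

noncomputable section

set_option linter.dupNamespace false

open MeasureTheory Set Filter Topology Metric Function
open scoped RealInnerProductSpace Topology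

namespace Summit.NavierStokesRegularity.NavierStokesRegularity.Theorems.PowerGaugeEulerLiouville

open Literature.Analysis Literature.Analysis.FluidPDE

namespace ClassicalProfile

/-! ## §1 The smooth cutoff `χ_k(t) = S((k+1)t − 1)·S((k+1)(δ − t))` -/

/-- `0 ≤ χ_k ≤ 1`. [folklore] -/
theorem tentCutoff_mem_Icc (k : ℕ) (δ t : ℝ) :
    Real.smoothTransition (((k : ℝ) + 1) * t - 1) * Real.smoothTransition (((k : ℝ) + 1) * (δ - t)) ∈ Icc (0 : ℝ) 1 :=
  ⟨mul_nonneg (Real.smoothTransition.nonneg _) (Real.smoothTransition.nonneg _),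
    mul_le_one₀ (Real.smoothTransition.le_one _) (Real.smoothTransition.nonneg _) (Real.smoothTransition.le_one _)⟩

/-- `χ_k(t) = 0` for `t ≤ 1/(k+1)` (the first factor vanishes). [folklore] -/
theorem tentCutoff_eq_zero_of_le_inv (k : ℕ) (δ : ℝ) {t : ℝ} (ht : t ≤ 1 / ((k : ℝ) + 1)) :
    Real.smoothTransition (((k : ℝ) + 1) * t - 1) * Real.smoothTransition (((k : ℝ) + 1) * (δ - t)) = 0 := by
  have hN : 0 < (k : ℝ) + 1 := by positivity
  have h : ((k : ℝ) + 1) * t - 1 ≤ 0 := by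
    have := mul_le_mul_of_nonneg_left ht hN.le
    rw [mul_one_div_cancel hN.ne'] at this
    linarith
  rw [Real.smoothTransition.zero_of_nonpos h, zero_mul]

/-- `χ_k(t) = 0` for `t ≥ δ` (the second factor vanishes). [folklore] -/
theorem tentCutoff_eq_zero_of_le (k : ℕ) {δ t : ℝ} (ht : δ ≤ t) :
    Real.smoothTransition (((k : ℝ) + 1) * t - 1) * Real.smoothTransition (((k : ℝ) + 1) * (δ - t)) = 0 := by
  have hN : 0 < (k : ℝ) + 1 := by positivity
  have h : ((k : ℝ) + 1) * (δ - t) ≤ 0 := mul_nonpos_of_nonneg_of_nonpos hN.le (by linarith)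
  rw [Real.smoothTransition.zero_of_nonpos h, mul_zero]

/-- `χ_k` is smooth. [folklore] -/
theorem contDiff_tentCutoff (k : ℕ) (δ : ℝ) {n : ℕ∞} :
    ContDiff ℝ n fun t : ℝ =>
      Real.smoothTransition (((k : ℝ) + 1) * t - 1) * Real.smoothTransition (((k : ℝ) + 1) * (δ - t)) :=
  (Real.smoothTransition.contDiff.comp ((contDiff_const.mul contDiff_id).sub contDiff_const)).mul
    (Real.smoothTransition.contDiff.comp (contDiff_const.mul (contDiff_const.sub contDiff_id)))

/-- `χ_k` is continuous. [folklore] -/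
theorem continuous_tentCutoff (k : ℕ) (δ : ℝ) :
    Continuous fun t : ℝ =>
      Real.smoothTransition (((k : ℝ) + 1) * t - 1) * Real.smoothTransition (((k : ℝ) + 1) * (δ - t)) :=
  (contDiff_tentCutoff k δ (n := 0)).continuous

/-- `χ_k(t) → 1` as `k → ∞` for `0 < t < δ` (both factors are eventually equal to `1`). [folklore] -/
theorem tendsto_tentCutoff {δ t : ℝ} (ht : 0 < t) (htδ : t < δ) :
    Tendsto (fun k : ℕ =>
      Real.smoothTransition (((k : ℝ) + 1) * t - 1) * Real.smoothTransition (((k : ℝ) + 1) * (δ - t))) atTop (𝓝 1) := by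
  have hk : Tendsto (fun k : ℕ => (k : ℝ) + 1) atTop atTop :=
    tendsto_natCast_atTop_atTop.atTop_add tendsto_const_nhds
  have h1 : ∀ᶠ k : ℕ in atTop, 2 / t ≤ (k : ℝ) + 1 := hk.eventually (eventually_ge_atTop _)
  have h2 : ∀ᶠ k : ℕ in atTop, 1 / (δ - t) ≤ (k : ℝ) + 1 := hk.eventually (eventually_ge_atTop _)
  refine tendsto_const_nhds.congr' ?_
  filter_upwards [h1, h2] with k hk1 hk2
  have hδt : 0 < δ - t := by linarith
  have e1 : 1 ≤ ((k : ℝ) + 1) * t - 1 := by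
    have := mul_le_mul_of_nonneg_right hk1 ht.le
    rw [div_mul_cancel₀ _ ht.ne'] at this
    linarith
  have e2 : 1 ≤ ((k : ℝ) + 1) * (δ - t) := by
    have := mul_le_mul_of_nonneg_right hk2 hδt.le
    rwa [div_mul_cancel₀ _ hδt.ne'] at this
  rw [Real.smoothTransition.one_of_one_le e1, Real.smoothTransition.one_of_one_le e2, mul_one]

/-! ## §2 The tent weights `g_k(t) = ∫_t^δ χ_k` -/

/-- `g_k′ = −χ_k`. [folklore] -/
theorem hasDerivAt_tentWeight (k : ℕ) (δ t : ℝ) :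
    HasDerivAt (fun t : ℝ => ∫ r in t..δ,
        Real.smoothTransition (((k : ℝ) + 1) * r - 1) * Real.smoothTransition (((k : ℝ) + 1) * (δ - r)))
      (-(Real.smoothTransition (((k : ℝ) + 1) * t - 1) * Real.smoothTransition (((k : ℝ) + 1) * (δ - t)))) t :=
  intervalIntegral.integral_hasDerivAt_left ((continuous_tentCutoff k δ).intervalIntegrable _ _)
    ((continuous_tentCutoff k δ).stronglyMeasurableAtFilter _ _) (continuous_tentCutoff k δ).continuousAt

/-- `g_k ∈ C¹`. [folklore] -/
theorem contDiff_tentWeight (k : ℕ) (δ : ℝ) :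
    ContDiff ℝ 1 fun t : ℝ => ∫ r in t..δ,
      Real.smoothTransition (((k : ℝ) + 1) * r - 1) * Real.smoothTransition (((k : ℝ) + 1) * (δ - r)) := by
  rw [contDiff_one_iff_deriv]
  refine ⟨fun t => (hasDerivAt_tentWeight k δ t).differentiableAt, ?_⟩
  have e : deriv (fun t : ℝ => ∫ r in t..δ,
      Real.smoothTransition (((k : ℝ) + 1) * r - 1) * Real.smoothTransition (((k : ℝ) + 1) * (δ - r))) =
      fun t => -(Real.smoothTransition (((k : ℝ) + 1) * t - 1) * Real.smoothTransition (((k : ℝ) + 1) * (δ - t))) :=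
    funext fun t => (hasDerivAt_tentWeight k δ t).deriv
  rw [e]
  exact (continuous_tentCutoff k δ).neg

/-- `g_k` is continuous. [folklore] -/
theorem continuous_tentWeight (k : ℕ) (δ : ℝ) :
    Continuous fun t : ℝ => ∫ r in t..δ,
      Real.smoothTransition (((k : ℝ) + 1) * r - 1) * Real.smoothTransition (((k : ℝ) + 1) * (δ - r)) :=
  (contDiff_tentWeight k δ).continuous

/-- `g_k(t) = 0` for `t ≥ δ`. [folklore] -/
theorem tentWeight_eq_zero_of_le (k : ℕ) {δ t : ℝ} (ht : δ ≤ t) :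
    ∫ r in t..δ, Real.smoothTransition (((k : ℝ) + 1) * r - 1) * Real.smoothTransition (((k : ℝ) + 1) * (δ - r)) = 0 := by
  rw [intervalIntegral.integral_symm]
  rw [intervalIntegral.integral_congr (g := fun _ => (0 : ℝ)) fun r hr => ?_]
  · simp
  · rw [uIcc_of_le ht] at hr
    exact tentCutoff_eq_zero_of_le k hr.1

/-- `g_k(t) = g_k(0)` for `t ≤ 1/(k+1)` (`χ_k` vanishes on `(−∞, 1/(k+1)]`): the weight is FLAT near the origin. [folklore] -/
theorem tentWeight_eq_tentWeight_zero (k : ℕ) (δ : ℝ) {t : ℝ} (ht : t ≤ 1 / ((k : ℝ) + 1)) :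
    ∫ r in t..δ, Real.smoothTransition (((k : ℝ) + 1) * r - 1) * Real.smoothTransition (((k : ℝ) + 1) * (δ - r)) =
      ∫ r in (0 : ℝ)..δ, Real.smoothTransition (((k : ℝ) + 1) * r - 1) * Real.smoothTransition (((k : ℝ) + 1) * (δ - r)) := by
  have hc := continuous_tentCutoff k δ
  have h0 : ∫ r in t..(0 : ℝ),
      Real.smoothTransition (((k : ℝ) + 1) * r - 1) * Real.smoothTransition (((k : ℝ) + 1) * (δ - r)) = 0 := by
    rw [intervalIntegral.integral_congr (g := fun _ => (0 : ℝ)) fun r hr => ?_]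
    · simp
    · have hN : 0 < 1 / ((k : ℝ) + 1) := by positivity
      have hr' : r ≤ 1 / ((k : ℝ) + 1) := by
        rcases le_total t 0 with h | h
        · rw [uIcc_of_le h] at hr; exact hr.2.trans hN.le
        · rw [uIcc_of_ge h] at hr; exact hr.2.trans ht
      exact tentCutoff_eq_zero_of_le_inv k δ hr'
  rw [← intervalIntegral.integral_add_adjacent_intervals (hc.intervalIntegrable (μ := volume) t 0)
    (hc.intervalIntegrable (μ := volume) 0 δ), h0, zero_add]

/-- `0 ≤ g_k(t) ≤ δ − t` for `t ∈ [0, δ]` (hence `g_k ≤ δ`). [folklore] -/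
theorem tentWeight_mem_Icc (k : ℕ) {δ t : ℝ} (ht : t ∈ Icc 0 δ) :
    (∫ r in t..δ, Real.smoothTransition (((k : ℝ) + 1) * r - 1) * Real.smoothTransition (((k : ℝ) + 1) * (δ - r))) ∈
      Icc 0 (δ - t) := by
  refine ⟨intervalIntegral.integral_nonneg ht.2 fun r _ => (tentCutoff_mem_Icc k δ r).1, ?_⟩
  have h := intervalIntegral.integral_mono_on (μ := volume) ht.2
    ((continuous_tentCutoff k δ).intervalIntegrable _ _)
    (intervalIntegrable_const (c := (1 : ℝ))) fun r _ => (tentCutoff_mem_Icc k δ r).2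
  simpa using h

/-- `g_k(t) → δ − t` as `k → ∞` for `t ∈ [0, δ]` (dominated convergence on `[t, δ]`, `χ_k → 1` off `{δ}`). [folklore] -/
theorem tendsto_tentWeight {δ t : ℝ} (ht : t ∈ Icc 0 δ) :
    Tendsto (fun k : ℕ => ∫ r in t..δ,
        Real.smoothTransition (((k : ℝ) + 1) * r - 1) * Real.smoothTransition (((k : ℝ) + 1) * (δ - r)))
      atTop (𝓝 (δ - t)) := by
  have hlim : ∫ _ in t..δ, (1 : ℝ) = δ - t := by simp
  rw [← hlim]
  refine intervalIntegral.tendsto_integral_filter_of_dominated_convergence (fun _ => (1 : ℝ))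
    (Eventually.of_forall fun k => (continuous_tentCutoff k δ).aestronglyMeasurable)
    (Eventually.of_forall fun k => ae_of_all _ fun r _ => ?_) intervalIntegrable_const ?_
  · rw [Real.norm_eq_abs, abs_of_nonneg (tentCutoff_mem_Icc k δ r).1]
    exact (tentCutoff_mem_Icc k δ r).2
  · have hδ : ∀ᵐ r : ℝ ∂volume, r ≠ δ := by
      have : (volume : Measure ℝ) {δ} = 0 := measure_singleton δ
      exact compl_mem_ae_iff.mpr this
    filter_upwards [hδ] with r hrδ hr
    rw [uIoc_of_le ht.2] at hr
    exact tendsto_tentCutoff (lt_of_le_of_lt ht.1 hr.1) (lt_of_le_of_ne hr.2 hrδ)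

/-! ## §3 The radial weights `ψ_k(s) = g_k(√|s|)` are admissible in the radial virial identity -/

/-- Near the origin the radial weight is constant: `g_k(√|s|) = g_k(0)` for `|s| < (1/(k+1))²`. [folklore] -/
theorem tentRadial_eq_of_abs_lt (k : ℕ) (δ : ℝ) {s : ℝ} (hs : |s| < (1 / ((k : ℝ) + 1)) ^ 2) :
    ∫ r in Real.sqrt |s|..δ,
        Real.smoothTransition (((k : ℝ) + 1) * r - 1) * Real.smoothTransition (((k : ℝ) + 1) * (δ - r)) =
      ∫ r in (0 : ℝ)..δ, Real.smoothTransition (((k : ℝ) + 1) * r - 1) * Real.smoothTransition (((k : ℝ) + 1) * (δ - r)) := by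
  refine tentWeight_eq_tentWeight_zero k δ ?_
  have hN : 0 ≤ 1 / ((k : ℝ) + 1) := by positivity
  rw [← Real.sqrt_sq hN]
  exact Real.sqrt_le_sqrt hs.le

/-- **`ψ_k ∈ C¹(ℝ)`**: locally constant across `s = 0`, and `g_k ∘ √·` (resp. `g_k ∘ √(−·)`) away from it. [folklore] -/
theorem contDiff_tentRadial (k : ℕ) (δ : ℝ) :
    ContDiff ℝ 1 fun s : ℝ => ∫ r in Real.sqrt |s|..δ,
      Real.smoothTransition (((k : ℝ) + 1) * r - 1) * Real.smoothTransition (((k : ℝ) + 1) * (δ - r)) := by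
  have hg := contDiff_tentWeight k δ
  have hN : 0 < (1 / ((k : ℝ) + 1)) ^ 2 := by positivity
  refine contDiff_iff_contDiffAt.2 fun s => ?_
  by_cases hs : |s| < (1 / ((k : ℝ) + 1)) ^ 2
  · -- locally constant
    have hopen : IsOpen {s' : ℝ | |s'| < (1 / ((k : ℝ) + 1)) ^ 2} := isOpen_lt continuous_abs continuous_const
    have hev : (fun s' : ℝ => ∫ r in Real.sqrt |s'|..δ,
        Real.smoothTransition (((k : ℝ) + 1) * r - 1) * Real.smoothTransition (((k : ℝ) + 1) * (δ - r))) =ᶠ[𝓝 s]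
        fun _ => ∫ r in (0 : ℝ)..δ,
          Real.smoothTransition (((k : ℝ) + 1) * r - 1) * Real.smoothTransition (((k : ℝ) + 1) * (δ - r)) :=
      Filter.eventually_of_mem (hopen.mem_nhds hs) fun s' hs' => tentRadial_eq_of_abs_lt k δ hs'
    exact (contDiffAt_const.congr_of_eventuallyEq hev)
  · have hs0 : s ≠ 0 := by
      intro h; rw [h, abs_zero] at hs; exact hs hN
    rcases lt_or_gt_of_ne hs0 with hneg | hpos
    · -- `s < 0`: `√|s'| = √(−s')` near `s`
      have hev : (fun s' : ℝ => ∫ r in Real.sqrt |s'|..δ,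
          Real.smoothTransition (((k : ℝ) + 1) * r - 1) * Real.smoothTransition (((k : ℝ) + 1) * (δ - r))) =ᶠ[𝓝 s]
          fun s' => ∫ r in Real.sqrt (-s')..δ,
            Real.smoothTransition (((k : ℝ) + 1) * r - 1) * Real.smoothTransition (((k : ℝ) + 1) * (δ - r)) :=
        Filter.eventually_of_mem (Iio_mem_nhds hneg) fun s' (hs' : s' < 0) => by simp only [abs_of_neg hs']
      refine ContDiffAt.congr_of_eventuallyEq ?_ hev
      exact hg.contDiffAt.comp s ((Real.contDiffAt_sqrt (neg_ne_zero.2 hs0)).comp s contDiffAt_id.neg)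
    · -- `s > 0`: `√|s'| = √s'` near `s`
      have hev : (fun s' : ℝ => ∫ r in Real.sqrt |s'|..δ,
          Real.smoothTransition (((k : ℝ) + 1) * r - 1) * Real.smoothTransition (((k : ℝ) + 1) * (δ - r))) =ᶠ[𝓝 s]
          fun s' => ∫ r in Real.sqrt s'..δ,
            Real.smoothTransition (((k : ℝ) + 1) * r - 1) * Real.smoothTransition (((k : ℝ) + 1) * (δ - r)) :=
        Filter.eventually_of_mem (Ioi_mem_nhds hpos) fun s' (hs' : 0 < s') => by simp only [abs_of_pos hs']
      refine ContDiffAt.congr_of_eventuallyEq ?_ hev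
      exact hg.contDiffAt.comp s (Real.contDiffAt_sqrt hs0)

/-- **`ψ_k` has compact support** (in `[−δ², δ²]`: `√|s| ≥ δ` forces `g_k = 0`). [folklore] -/
theorem hasCompactSupport_tentRadial (k : ℕ) (δ : ℝ) :
    HasCompactSupport fun s : ℝ => ∫ r in Real.sqrt |s|..δ,
      Real.smoothTransition (((k : ℝ) + 1) * r - 1) * Real.smoothTransition (((k : ℝ) + 1) * (δ - r)) := by
  refine HasCompactSupport.intro (isCompact_Icc (a := -(δ ^ 2)) (b := δ ^ 2)) fun s hs => ?_
  refine tentWeight_eq_zero_of_le k ?_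
  have hs' : δ ^ 2 ≤ |s| := by
    simp only [mem_Icc, not_and_or, not_le] at hs
    rcases hs with h | h
    · have : s < 0 := by nlinarith [sq_nonneg δ]
      rw [abs_of_neg this]; linarith
    · exact (le_abs_self s).trans' h.le
  rcases le_or_gt 0 δ with hδ | hδ
  · calc δ = Real.sqrt (δ ^ 2) := (Real.sqrt_sq hδ).symm
      _ ≤ Real.sqrt |s| := Real.sqrt_le_sqrt hs'
  · exact hδ.le.trans (Real.sqrt_nonneg _)

/-- Along `s = ‖z‖²`: `ψ_k(‖z‖²) = g_k(‖z‖)`. [folklore] -/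
theorem tentRadial_normSq (k : ℕ) (δ : ℝ) (z : EuclideanSpace ℝ (Fin 3)) :
    (∫ r in Real.sqrt |‖z‖ ^ 2|..δ,
        Real.smoothTransition (((k : ℝ) + 1) * r - 1) * Real.smoothTransition (((k : ℝ) + 1) * (δ - r))) =
      ∫ r in ‖z‖..δ, Real.smoothTransition (((k : ℝ) + 1) * r - 1) * Real.smoothTransition (((k : ℝ) + 1) * (δ - r)) := by
  rw [abs_of_nonneg (sq_nonneg _), Real.sqrt_sq (norm_nonneg _)]

/-- Along `s = ‖z‖²`, `z ≠ 0`: `ψ_k′(‖z‖²) = −χ_k(‖z‖)/(2‖z‖)` (chain rule through `√·`). [folklore] -/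
theorem deriv_tentRadial_normSq (k : ℕ) (δ : ℝ) {z : EuclideanSpace ℝ (Fin 3)} (hz : z ≠ 0) :
    deriv (fun s : ℝ => ∫ r in Real.sqrt |s|..δ,
        Real.smoothTransition (((k : ℝ) + 1) * r - 1) * Real.smoothTransition (((k : ℝ) + 1) * (δ - r))) (‖z‖ ^ 2) =
      -(Real.smoothTransition (((k : ℝ) + 1) * ‖z‖ - 1) * Real.smoothTransition (((k : ℝ) + 1) * (δ - ‖z‖))) /
        (2 * ‖z‖) := by
  have hpos : 0 < ‖z‖ ^ 2 := by positivity
  have hev : (fun s' : ℝ => ∫ r in Real.sqrt |s'|..δ,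
      Real.smoothTransition (((k : ℝ) + 1) * r - 1) * Real.smoothTransition (((k : ℝ) + 1) * (δ - r))) =ᶠ[𝓝 (‖z‖ ^ 2)]
      fun s' => ∫ r in Real.sqrt s'..δ,
        Real.smoothTransition (((k : ℝ) + 1) * r - 1) * Real.smoothTransition (((k : ℝ) + 1) * (δ - r)) :=
    Filter.eventually_of_mem (Ioi_mem_nhds hpos) fun s' (hs' : 0 < s') => by simp only [abs_of_pos hs']
  have hchain := (hasDerivAt_tentWeight k δ (Real.sqrt (‖z‖ ^ 2))).comp (‖z‖ ^ 2) (Real.hasDerivAt_sqrt hpos.ne')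
  rw [(hchain.congr_of_eventuallyEq hev).deriv, Real.sqrt_sq (norm_nonneg _)]
  field_simp

end ClassicalProfile

end Summit.NavierStokesRegularity.NavierStokesRegularity.Theorems.PowerGaugeEulerLiouville

end
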